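import Summits.ABC.IUTFork.Joshi.TestTensorPacketsStrictMoves
import HarnessLib

/-!
# Block E, row D-09 — WHICH per-arithmeticoid exponents make the §9.4 strict move along `z_Θ` carry the Θ-regions onto the q-region

Proof-only sequel (D-0012; two small model-data definitions, NO `Prop` fact, no `sorry`) of `Joshi/TestTensorPacketsStrictMoves.lean`
(p433729; abc-iut cell, block E «type Joshi's construction, test vs S», rung LADDER-ABC:A2.E; seat abc-iut-E-t20, slot T-20 =
K. Joshi, *Construction of Arithmetic Teichmüller Spaces III*, arXiv:2401.13508 **v4** = `Joshi2024ATS3`, §9.4), answering the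
typer-side reader's located question (abc-iut-E-t56, AUDITED p433729, INFO I1: «`teleExp` is reverse-engineered to make the cumulative
product `p^{1−j²}` … hitting `1 − j²` exactly forces `e_a = 1 − 2a`»). TAKES NO SIDE on [IUTchIII] Cor. 3.12, on Joshi's claims or on
Mochizuki's report on them; typed ≠ proved; a model EXHIBITS (non-)satisfiability of typed hypotheses, nothing more; the cell locates /
conditionally verifies — NO abc claim.

CONTENT. For an ARBITRARY exponent assignment `e : ℕ → ℤ` (the factor of Mochizuki's capsule attached to the arithmeticoid `y′_a`,
the `a`-th entry of `z_Θ = (y′_0, y′_1, …, y′_{ℓ*})`, §9.4.4 p.102 l.22–28, rescales its carrier by `p^{e_a}` — `ppowG`), the strict move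
along `z_Θ` is CUMULATIVE (p433729 `line_strictMove_scalar`): it carries `B_k` onto `B_{k + Σ_{a ≤ j} e_a}` at label `j`
(`image_pBall_strictMove_ppowG`, any reading `A`/`I` of strip-automorphisms / Ism over the pinned ℚ-line carriers). Hence
* `strictMove_ppowG_theta_to_q_iff`: it carries the Θ-region `B_{j²}` onto the q-region `B_1` at label `j` iff `Σ_{a ≤ j} e_a = 1 − j²`;
* `sum_range_eq_one_sub_sq_iff` (pure arithmetic): these equations for `1 ≤ j ≤ N` hold iff `e_0 + e_1 = 0` and
  `e_a = 1 − 2a = (a−1)² − a²` for every `2 ≤ a ≤ N` — the factor attached to `y′_a` (`a ≥ 2`) must rescale by the valuation jump between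
  the CONSECUTIVE tuple entries `y′_{a−1}`, `y′_a` ([J-III] Thm. 4.2.2.1 (4) eq. (4.2.2.2) p.33: exponents `(a−1)²`, `a²` relative to
  `y′_1`), with ONE free parameter on the pair `(y′_0, y′_1)`;
* `theta_to_q_at_all_labels_iff`: over c312-7's `toyIndex` (`ℓ* = 2`) the strict move is the S-witnessing move of X-07′ at BOTH labels of
  `𝔽_l^⋆` iff `e_0 + e_1 = 0 ∧ e_2 = −3`; `teleExp = (1, −1, −3, …)` (p433729 §3) is one solution (`strictMove_tele_theta_to_q`,
  `teleExp_succ`).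
LOCATED arithmetic of row D-09 (cf. [J-III] Rmk. 9.4.6.9 «the appearance of certain powers in each factor», p.104 l.65–70): under the
§9.4 tensor-packet codomain, a valuation-rescaling move realising Joshi's untilt change label by label is pinned factor by factor to the
consecutive jumps; which assignment (if any) print intends is NOT adjudicated here. [claim: Joshi2024ATS3, status: disputed]
[claim: Mochizuki2012, status: disputed]
-/

noncomputable section

open Set

namespace Summit.ABC.IUTFork.Joshi

open Thm311 Cor312 Cor312Vol Cor312.Checks Cor312.IdentifiedNonVacuity Cor312Vol.NaiveWitness Cor312Vol.PinnedWitness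
  Literature.IUT.LogThetaLattice IsmScaling

section WhichExponents

/-- **Pure arithmetic**: a sequence `e : ℕ → ℤ` has partial sums `Σ_{i ≤ n} e_i = 1 − n²` for all `1 ≤ n ≤ N` iff `e_0 + e_1 = 0`
(when `N ≥ 1`) and `e_a = 1 − 2a` for `2 ≤ a ≤ N`. [folklore] -/
theorem sum_range_eq_one_sub_sq_iff (e : ℕ → ℤ) (N : ℕ) :
    (∀ n, 1 ≤ n → n ≤ N → ∑ i ∈ Finset.range (n + 1), e i = 1 - ((n ^ 2 : ℕ) : ℤ)) ↔
      ((1 ≤ N → e 0 + e 1 = 0) ∧ ∀ a, 2 ≤ a → a ≤ N → e a = 1 - 2 * (a : ℤ)) := by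
  have two : ∀ n : ℕ, ∑ i ∈ Finset.range (n + 2), e i = (∑ i ∈ Finset.range (n + 1), e i) + e (n + 1) := fun n =>
    Finset.sum_range_succ e (n + 1)
  have one : ∑ i ∈ Finset.range 2, e i = e 0 + e 1 := by
    rw [Finset.sum_range_succ, Finset.sum_range_succ, Finset.sum_range_zero, zero_add]
  constructor
  · intro h
    refine ⟨fun hN => ?_, fun a ha haN => ?_⟩
    · have h1 := h 1 le_rfl hN
      rw [one] at h1
      simpa using h1
    · obtain ⟨b, rfl⟩ : ∃ b, a = b + 2 := ⟨a - 2, by omega⟩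
      have hb1 := h (b + 1) (by omega) (by omega)
      have hb2 := h (b + 2) (by omega) haN
      rw [two (b + 1), hb1] at hb2
      push_cast at hb2 ⊢
      linear_combination hb2
  · rintro ⟨h01, hrest⟩ n hn hnN
    induction n with
    | zero => exact absurd hn (by omega)
    | succ m ih =>
        rcases Nat.eq_zero_or_pos m with rfl | hm
        · rw [one, h01 (by omega)]; norm_num
        · rw [two m, ih (by omega) (by omega), hrest (m + 1) (by omega) hnN]
          push_cast
          ring

/-- `teleExp` solves these equations for every `N`: `teleExp 0 + teleExp 1 = 0` … [folklore] -/
theorem teleExp_zero_add_one : teleExp 0 + teleExp 1 = 0 := by simp [teleExp]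

/-- … and `teleExp a = 1 − 2a = (a−1)² − a²` for `a ≥ 1` (the CONSECUTIVE valuation jump). [folklore] -/
theorem teleExp_succ (a : ℕ) : teleExp (a + 1) = 1 - 2 * ((a + 1 : ℕ) : ℤ) := by
  simp only [teleExp, Nat.succ_ne_zero, if_false, Nat.add_sub_cancel]
  push_cast
  ring

variable (A I : Set (ℚ ≃ₗ[ℚ] ℚ)) (hA : LinearEquiv.refl ℚ ℚ ∈ A) (hI : LinearEquiv.refl ℚ ℚ ∈ I) (p : ℕ) [hp : Fact p.Prime]

/-- The per-arithmeticoid units `p^{e_a}` for an arbitrary exponent assignment `e` (indexed by the position `a` of `y′_a` in `z_Θ`).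
MODEL DATA. [folklore] -/
def ppowUnits (e : ℕ → ℤ) (y : toyIndex.Label) : ℚˣ := ppowUnit p (e y)

/-- The realisation `G(y′_a)_w := (x ↦ p^{e_a}·x)`. MODEL DATA (`teleG` is the case `e = teleExp`, `ppowG_teleExp`). [folklore] -/
def ppowG (e : ℕ → ℤ) : toyIndex.Label → toyIndex.V → (ℚ ≃ₗ[ℚ] ℚ) := scalarMoves (ppowUnits p e)

/-- `teleG` is `ppowG teleExp`. [folklore] -/
theorem ppowG_teleExp : ppowG p teleExp = teleG p := rfl

/-- The cumulative scalar of `ppowG e` at label `j` is `p^{Σ_{a ≤ j} e_a}`. [folklore] -/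
theorem prod_ppowUnits (e : ℕ → ℤ) (j : toyIndex.Label) :
    (∏ a : toyIndex.Caps j, (ppowUnits p e ((labelDatum toyIndex).capsEntry id j a) : ℚ)) =
      (p : ℚ) ^ ∑ i ∈ Finset.range ((j : ℕ) + 1), e i := by
  have h1 : (∏ a : toyIndex.Caps j, (ppowUnits p e ((labelDatum toyIndex).capsEntry id j a) : ℚ)) =
      ∏ a : Fin ((j : ℕ) + 1), (p : ℚ) ^ e a := rfl
  rw [h1, prod_ppow_eq_ppow_sum, Fin.sum_univ_eq_sum_range (fun i => e i) ((j : ℕ) + 1)]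

/-- **Cumulativity, exponent form**: the strict move with exponents `e` carries `B_k` onto `B_{k + Σ_{a ≤ j} e_a}` at label `j`
(any reading `A`, `I`). [folklore] -/
theorem image_pBall_strictMove_ppowG (e : ℕ → ℤ) (j : toyIndex.Label) (vQ : toyIndex.VQ) (k : ℤ) :
    (labelDatum toyIndex).strictMove (lineShells A I hA hI) (ppowG p e) id j vQ '' pBall p j vQ k =
      pBall p j vQ (k + ∑ i ∈ Finset.range ((j : ℕ) + 1), e i) :=
  (image_pBall_strictMove_scalar A I hA hI p (labelDatum toyIndex) (ppowUnits p e) id j vQ k).trans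
    (by rw [prod_ppowUnits, padicValRat_ppow])

/-- **THE CRITERION at one label**: the strict move with exponents `e` carries the Θ-region `B_{j²}` onto the q-region `B_1` at
label `j` iff the CUMULATIVE exponent over the capsule `S_{j+1}` is `1 − j²`. [folklore] -/
theorem strictMove_ppowG_theta_to_q_iff (e : ℕ → ℤ) (j : toyIndex.Label) (vQ : toyIndex.VQ) :
    (labelDatum toyIndex).strictMove (lineShells A I hA hI) (ppowG p e) id j vQ '' pBall p j vQ (jsq j) = pBall p j vQ 1 ↔
      ∑ i ∈ Finset.range ((j : ℕ) + 1), e i = 1 - jsq j := by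
  rw [image_pBall_strictMove_ppowG]
  refine ⟨fun h => ?_, fun h => by rw [h, add_sub_cancel]⟩
  have h' := pBall_injective p j vQ h
  linarith

/-- **THE CRITERION over `toyIndex` (`ℓ* = 2`), solved**: the strict move along `z_Θ = (y′_0, y′_1, y′_2)` with exponents `e` carries
the Θ-region onto the q-region at BOTH labels of `𝔽_l^⋆` iff `e_0 + e_1 = 0 ∧ e_2 = −3` — the factor at `y′_2` must rescale by
`p^{1² − 2²}` (the consecutive jump), the pair `(y′_0, y′_1)` carries one free parameter. For general `ℓ*` the same computation
(`sum_range_eq_one_sub_sq_iff`) forces `e_a = (a−1)² − a²` for every `2 ≤ a ≤ ℓ*`. LOCATED arithmetic; no verdict. [folklore] -/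
theorem theta_to_q_at_all_labels_iff (e : ℕ → ℤ) (vQ : toyIndex.VQ) :
    (∀ j : toyIndex.Label, j ≠ 0 →
        (labelDatum toyIndex).strictMove (lineShells A I hA hI) (ppowG p e) id j vQ '' pBall p j vQ (jsq j) = pBall p j vQ 1) ↔
      (e 0 + e 1 = 0 ∧ e 2 = -3) := by
  have key : (∀ j : toyIndex.Label, j ≠ 0 → ∑ i ∈ Finset.range ((j : ℕ) + 1), e i = 1 - jsq j) ↔
      ∀ n, 1 ≤ n → n ≤ 2 → ∑ i ∈ Finset.range (n + 1), e i = 1 - ((n ^ 2 : ℕ) : ℤ) := by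
    constructor
    · intro h n hn hn2
      have hj : (⟨n, by show n < 2 + 1; omega⟩ : toyIndex.Label) ≠ 0 := fun h0 => by
        have := congrArg Fin.val h0
        simp only [Fin.val_zero] at this
        omega
      exact h ⟨n, by show n < 2 + 1; omega⟩ hj
    · intro h j hj
      have hj1 : 1 ≤ (j : ℕ) := Nat.one_le_iff_ne_zero.2 fun h0 => hj (Fin.ext h0)
      have hj2 : (j : ℕ) ≤ 2 := by have h3 : (j : ℕ) < 2 + 1 := j.2; omega
      exact h j hj1 hj2
  simp only [strictMove_ppowG_theta_to_q_iff]
  rw [key, sum_range_eq_one_sub_sq_iff]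
  constructor
  · rintro ⟨h01, h2⟩
    exact ⟨h01 (by norm_num), by have := h2 2 le_rfl le_rfl; simpa using this⟩
  · rintro ⟨h01, h2⟩
    refine ⟨fun _ => h01, fun a ha ha2 => ?_⟩
    obtain rfl : a = 2 := le_antisymm ha2 ha
    rw [h2]
    norm_num

/-- `teleExp` passes the criterion at every label (as §3 showed directly): `Σ_{a ≤ j} teleExp a = 1 − j²`. [folklore] -/
theorem strictMove_tele_theta_to_q (j : toyIndex.Label) (vQ : toyIndex.VQ) :
    (labelDatum toyIndex).strictMove (lineShells A I hA hI) (teleG p) id j vQ '' pBall p j vQ (jsq j) = pBall p j vQ 1 := by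
  rw [image_pBall_strictMove_tele, add_sub_cancel]

end WhichExponents

end Summit.ABC.IUTFork.Joshi

end
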